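import Summits.AnomalousDissipation.AnomalousDissipation.Theorems.DopplerClockQuadratureStressFloorEnergyFreeBridge
import Summits.AnomalousDissipation.AnomalousDissipation.Theorems.DopplerClockLongitudinalClassQuiet
import Literature.Analysis.FluidPDE.TorusClassicalLerayHopfProofs

/-!
# Crux `DopplerClock.QuadratureStressFloor` (stmt-AnomalousDissipation-18129) — negative side, I:
# the stress floor is a dissipation floor, so every QUIET witness class is excluded

Negative-side support from the cdisprove seat (`refuter-cdisprove-stmt-AnomalousDissipation-18129-0`).
The crux C1 is EXISTENTIAL: one design `(F, V, m, n)`, one generalized limit `Λ` and one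
vanishing-viscosity family of global Leray–Hopf drift-`V` solutions of the Doppler force
`f = F sin(2πm x₁) cos(2πn x₂) e₀` with pinned momentum `V e₂`, per-`j` energy bounds and no leakage,
whose quadrature stress has a `ν`-uniform floor `ε₀ ≤ −Λ⟨T_s(w_j)⟩`, `w_j = u_j − V e₂`,
`T_s(w) = ∫⟪w, (w·∇)Ψ_s⟫`, `Ψ_s = sin(2πm x₁) sin(2πn x₂) e₀`.  An unconditional `¬ C1` would be a
sweeping-decorrelation theorem for every such family (open), so this file records what a proof
of C1 CANNOT use — kernel-checked:

* `neg_longTimeAvg_stress_le` — **the floor is paid in dissipation, witness by witness**: for every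
  single no-leak drift-`V` Leray–Hopf solution at viscosity `ν > 0`,
  `−Λ⟨T_s(w)⟩ ≤ (c + κ²/(8π²)) · meanDissipation ν u + νκ²/2`, `c = 2πnV/F`, `κ² = (2π)²(m²+n²)`
  (identity 18133 solved for `−Λ⟨T_s⟩`, the energy-free clock-term bound at `δ = 1`, `Λ ≤ limsup`,
  no-leak).  Hence:
* `exists_neg_longTimeAvg_stress_lt_of_dormant` — a family whose mean dissipation tends to `0`
  ("dormant": laminar, relaminarising, `O(ν)`-dissipating, or merely `o(1)`) carries NO floor: for
  every `ε₀ > 0` some member has `−Λ⟨T_s(w_j)⟩ < ε₀`.  C1 is thus EXACTLY as hard as anomalous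
  dissipation for this one force at pinned momentum along no-leak witnesses (the per-witness,
  quantitative form of the landed equivalence `dopplerClock_quadratureStressFloor_iff_energyFreeInjectionFloor`).
* `not_quadratureStressFloor_longitudinalClass` — the crux restricted to `x₀`-INVARIANT classical
  witnesses (streak arrays, their transients and Galilean drifts, any streamwise-independent state)
  is FALSE: that class is quiet (`LongitudinalClassQuiet`, item 18134: dissipation
  `≤ ν κ²F²/(4V²(2πn)²)`).  Any witness of C1 must break the streamwise symmetry shared by the
  force and the pattern.

Companion file `Negative/LaminarWitnesses.lean`: the laminar family meets clauses (i)–(v) with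
`T_s ≡ 0` (the `∀`-families strengthening is false), the momentum pinning is load-bearing, and the
guards `0 < m`, `0 < n` are necessary.  No new definitions; nothing here asserts a Theses statement
positively.  References: Doering–Foias 2002 §2; Foias–Manley–Rosa–Temam 2001 Ch. IV §1;
Alexakis–Doering 2006 §2.
-/
noncomputable section

-- `Summit.<Summit>.<Problem>` is the tree's mandated summit-side namespace (CONVENTIONS §2); for this
-- single-conjunct summit the two coincide, so the duplicate is deliberate.
set_option linter.dupNamespace false

open MeasureTheory Set Filter Topology
open scoped InnerProductSpace RealInnerProductSpace

namespace Summit.AnomalousDissipation.AnomalousDissipation.Theorems.QuadratureStressFloor.Negative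

open Literature.Analysis.FunctionSpaces Literature.Analysis.FunctionSpaces.Torus
open Literature.Analysis.FluidPDE Literature.Analysis.FluidPDE.Torus
open Summit.AnomalousDissipation.AnomalousDissipation.Theorems


/-! ### (a) The stress floor is a dissipation floor, witness by witness -/

open EnergyFreeBridge in
/-- **The quadrature-stress floor is paid in dissipation (per witness, energy-free).** For a global
Leray–Hopf drift-`V` solution `u` of the Doppler force at viscosity `ν > 0` with a forward energy bound
and no leakage, `−Λ⟨T_s(u − V e₂)⟩ ≤ (2πnV/F + κ²/(8π²)) · meanDissipation ν u + νκ²/2`,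
`κ² = (2π)²(m² + n²)`: the work identity (item 18133) solved for `−Λ⟨T_s⟩`, the energy-free clock-term
bound `|Λ⟨(Ψ_s,u)⟩| ≤ ½ + Λ⟨(f,u)⟩/(8π²ν)` (`EnergyFreeBridge.abs_longTimeAvg_inner_le`, `δ = 1`),
`Λ ≤ limsup` on the bounded injection means and the no-leak clause. [folklore] -/
theorem neg_longTimeAvg_stress_le (Λ : GeneralizedLimit) {F V ν : ℝ} {m n : ℕ} {u₀ : UnitAddTorus (Fin 3) → EuclideanSpace ℝ (Fin 3)}
    {u : ℝ → UnitAddTorus (Fin 3) → EuclideanSpace ℝ (Fin 3)} (hF : 0 < F) (hV : 0 < V) (hν : 0 < ν) (hm : 0 < m) (hn : 0 < n)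
    (hLH : IsGlobalLerayHopf ν (fun _ => fun x : UnitAddTorus (Fin 3) => (F * (UnitAddTorus.mFourier (Pi.single (1 : Fin 3) ((m : ℕ) : ℤ)) x).im * (UnitAddTorus.mFourier (Pi.single (2 : Fin 3) ((n : ℕ) : ℤ)) x).re) • EuclideanSpace.single (0 : Fin 3) (1 : ℝ)) u₀ u)
    (hmom : ∫ x, u₀ x = V • EuclideanSpace.single (2 : Fin 3) (1 : ℝ))
    (hsup : ∃ C : ℝ, ∀ t : ℝ, 0 ≤ t → kineticEnergy (u t) ≤ C)
    (hnoleak : longTimeAvgSup (fun t => ∫ x, ⟪(F * (UnitAddTorus.mFourier (Pi.single (1 : Fin 3) ((m : ℕ) : ℤ)) x).im * (UnitAddTorus.mFourier (Pi.single (2 : Fin 3) ((n : ℕ) : ℤ)) x).re) • EuclideanSpace.single (0 : Fin 3) (1 : ℝ), u t x⟫) ≤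
      meanDissipation ν u) :
    -Λ.longTimeAvg (fun t => ∫ x, ⟪u t x - V • EuclideanSpace.single (2 : Fin 3) (1 : ℝ),
        convect (fun y => u t y - V • EuclideanSpace.single (2 : Fin 3) (1 : ℝ)) (fun y : UnitAddTorus (Fin 3) => ((UnitAddTorus.mFourier (Pi.single (1 : Fin 3) ((m : ℕ) : ℤ)) y).im * (UnitAddTorus.mFourier (Pi.single (2 : Fin 3) ((n : ℕ) : ℤ)) y).im) • EuclideanSpace.single (0 : Fin 3) (1 : ℝ)) x⟫) ≤
      (V * (2 * Real.pi * n) / F + (2 * Real.pi) ^ 2 * ((m : ℝ) ^ 2 + (n : ℝ) ^ 2) / (8 * Real.pi ^ 2)) *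
          meanDissipation ν u +
        ν * ((2 * Real.pi) ^ 2 * ((m : ℝ) ^ 2 + (n : ℝ) ^ 2)) / 2 := by
  -- abbreviations for the force and the quadrature pattern
  set f : UnitAddTorus (Fin 3) → EuclideanSpace ℝ (Fin 3) := fun x => (F * (UnitAddTorus.mFourier (Pi.single (1 : Fin 3) ((m : ℕ) : ℤ)) x).im * (UnitAddTorus.mFourier (Pi.single (2 : Fin 3) ((n : ℕ) : ℤ)) x).re) • EuclideanSpace.single (0 : Fin 3) (1 : ℝ) with hfdef
  set Ψ : UnitAddTorus (Fin 3) → EuclideanSpace ℝ (Fin 3) := fun y => ((UnitAddTorus.mFourier (Pi.single (1 : Fin 3) ((m : ℕ) : ℤ)) y).im * (UnitAddTorus.mFourier (Pi.single (2 : Fin 3) ((n : ℕ) : ℤ)) y).im) • EuclideanSpace.single (0 : Fin 3) (1 : ℝ) with hΨdef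
  have hfS : IsSmooth f := dopplerClock_isSmooth_im_mul_re_smul F _ _ _
  have hf0 : HasZeroMean f := dopplerForce_hasZeroMean F _ _
  have hΨc : Continuous Ψ := (dopplerClock_isSmooth_im_mul_im_smul _ _ _).continuous
  have hΨ0 : HasZeroMean Ψ := pattern_hasZeroMean hm n
  have hΨ1 : ∀ x, ‖Ψ x‖ ≤ 1 := norm_pattern_le_one m n
  -- constants
  have hn' : (0 : ℝ) < (n : ℝ) := Nat.cast_pos.2 hn
  set κ2 : ℝ := (2 * Real.pi) ^ 2 * ((m : ℝ) ^ 2 + (n : ℝ) ^ 2) with hκ2def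
  have hκ2 : 0 ≤ κ2 := by rw [hκ2def]; positivity
  set c : ℝ := V * (2 * Real.pi * n) / F with hcdef
  have hc : 0 < c := by rw [hcdef]; positivity
  -- the identity, solved for `−Λ⟨T_s⟩`
  have hid : -Λ.longTimeAvg (fun t => ∫ x, ⟪u t x - V • EuclideanSpace.single (2 : Fin 3) (1 : ℝ), convect (fun y => u t y - V • EuclideanSpace.single (2 : Fin 3) (1 : ℝ)) Ψ x⟫) =
      c * Λ.longTimeAvg (fun t => ∫ x, ⟪f x, u t x⟫) -
        ν * κ2 * Λ.longTimeAvg (fun t => ∫ x, ⟪Ψ x, u t x⟫) := by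
    have h := dopplerWorkIdentity_proof Λ F V ν m n u₀ u hV hν hn hLH hmom hsup
    have hFne : F ≠ 0 := hF.ne'
    have hVne : V * (2 * Real.pi * n) ≠ 0 := by positivity
    rw [hcdef, h]
    field_simp
    ring
  -- the clock-term bound at `δ = 1`
  have hB : |Λ.longTimeAvg (fun t => ∫ x, ⟪Ψ x, u t x⟫)| ≤
      1 / 2 + 1 ^ 2 / (8 * Real.pi ^ 2 * ν * 1) * Λ.longTimeAvg (fun t => ∫ x, ⟪f x, u t x⟫) :=
    abs_longTimeAvg_inner_le Λ hν hfS hf0 hLH hsup hΨc hΨ0 hΨ1 one_pos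
  -- `Λ⟨(f,u)⟩ ≤ ⟨(f,u)⟩⁺ ≤ meanDissipation` (no leak)
  have hP : Λ.longTimeAvg (fun t => ∫ x, ⟪f x, u t x⟫) ≤ meanDissipation ν u :=
    (LoudWakes.longTimeAvg_inner_le_longTimeAvgSup Λ hfS.continuous hLH hsup).trans hnoleak
  -- arithmetic
  set P := Λ.longTimeAvg (fun t => ∫ x, ⟪f x, u t x⟫) with hPdef
  set B := Λ.longTimeAvg (fun t => ∫ x, ⟪Ψ x, u t x⟫) with hBdef
  have hpi : 0 < Real.pi ^ 2 := by positivity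
  have h1 : ν * κ2 * (-B) ≤ ν * κ2 * (1 / 2 + 1 ^ 2 / (8 * Real.pi ^ 2 * ν * 1) * P) :=
    mul_le_mul_of_nonneg_left ((neg_le_abs B).trans hB) (mul_nonneg hν.le hκ2)
  have h2 : ν * κ2 * (1 / 2 + 1 ^ 2 / (8 * Real.pi ^ 2 * ν * 1) * P) =
      ν * κ2 / 2 + κ2 / (8 * Real.pi ^ 2) * P := by
    field_simp
  have h3 : (c + κ2 / (8 * Real.pi ^ 2)) * P ≤ (c + κ2 / (8 * Real.pi ^ 2)) * meanDissipation ν u :=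
    mul_le_mul_of_nonneg_left hP (by positivity)
  rw [hid]
  nlinarith [h1, h2, h3]

/-- **Dormant families carry no floor.** Along any family of no-leak drift-`V` Leray–Hopf solutions of
the Doppler force with `ν_j → 0` whose mean dissipation tends to zero, the quadrature stress has no
`ν`-uniform floor: for every `ε₀ > 0` some member has `−Λ⟨T_s(w_j)⟩ < ε₀`
(`neg_longTimeAvg_stress_le` and `(c + κ²/(8π²))·ε̄_j + ν_jκ²/2 → 0`). In particular every witness
family of C1 is anomalously dissipating in `limsup`-mean: `liminf_j meanDissipation (ν_j) (u_j) > 0`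
along a subsequence. [folklore] -/
theorem exists_neg_longTimeAvg_stress_lt_of_dormant (Λ : GeneralizedLimit) {F V : ℝ} {m n : ℕ}
    {ν : ℕ → ℝ} {u₀ : ℕ → UnitAddTorus (Fin 3) → EuclideanSpace ℝ (Fin 3)} {u : ℕ → ℝ → UnitAddTorus (Fin 3) → EuclideanSpace ℝ (Fin 3)}
    (hF : 0 < F) (hV : 0 < V) (hm : 0 < m) (hn : 0 < n) (hν : ∀ j, 0 < ν j)
    (hν0 : Tendsto ν atTop (𝓝 0))
    (hLH : ∀ j, IsGlobalLerayHopf (ν j) (fun _ => fun x : UnitAddTorus (Fin 3) => (F * (UnitAddTorus.mFourier (Pi.single (1 : Fin 3) ((m : ℕ) : ℤ)) x).im * (UnitAddTorus.mFourier (Pi.single (2 : Fin 3) ((n : ℕ) : ℤ)) x).re) • EuclideanSpace.single (0 : Fin 3) (1 : ℝ))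
      (u₀ j) (u j))
    (hmom : ∀ j, ∫ x, u₀ j x = V • EuclideanSpace.single (2 : Fin 3) (1 : ℝ))
    (hsup : ∀ j, ∃ C : ℝ, ∀ t : ℝ, 0 ≤ t → kineticEnergy (u j t) ≤ C)
    (hnoleak : ∀ j, longTimeAvgSup (fun t => ∫ x, ⟪(F * (UnitAddTorus.mFourier (Pi.single (1 : Fin 3) ((m : ℕ) : ℤ)) x).im * (UnitAddTorus.mFourier (Pi.single (2 : Fin 3) ((n : ℕ) : ℤ)) x).re) • EuclideanSpace.single (0 : Fin 3) (1 : ℝ), u j t x⟫) ≤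
      meanDissipation (ν j) (u j))
    (hdormant : Tendsto (fun j => meanDissipation (ν j) (u j)) atTop (𝓝 0)) {ε₀ : ℝ} (hε₀ : 0 < ε₀) :
    ∃ j, -Λ.longTimeAvg (fun t => ∫ x, ⟪u j t x - V • EuclideanSpace.single (2 : Fin 3) (1 : ℝ),
        convect (fun y => u j t y - V • EuclideanSpace.single (2 : Fin 3) (1 : ℝ)) (fun y : UnitAddTorus (Fin 3) => ((UnitAddTorus.mFourier (Pi.single (1 : Fin 3) ((m : ℕ) : ℤ)) y).im * (UnitAddTorus.mFourier (Pi.single (2 : Fin 3) ((n : ℕ) : ℤ)) y).im) • EuclideanSpace.single (0 : Fin 3) (1 : ℝ)) x⟫) < ε₀ := by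
  set κ2 : ℝ := (2 * Real.pi) ^ 2 * ((m : ℝ) ^ 2 + (n : ℝ) ^ 2) with hκ2def
  set c : ℝ := V * (2 * Real.pi * n) / F with hcdef
  -- the per-witness bound tends to `0`
  have hlim : Tendsto (fun j => (c + κ2 / (8 * Real.pi ^ 2)) * meanDissipation (ν j) (u j) + ν j * κ2 / 2)
      atTop (𝓝 0) := by
    have h1 : Tendsto (fun j => (c + κ2 / (8 * Real.pi ^ 2)) * meanDissipation (ν j) (u j)) atTop (𝓝 0) := by
      simpa using hdormant.const_mul (c + κ2 / (8 * Real.pi ^ 2))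
    have h2 : Tendsto (fun j => ν j * κ2 / 2) atTop (𝓝 0) := by
      simpa using (hν0.mul_const κ2).div_const 2
    simpa using h1.add h2
  obtain ⟨j, hj⟩ := (eventually_atTop.1 (hlim.eventually (gt_mem_nhds hε₀)))
  refine ⟨j, ?_⟩
  have hle := neg_longTimeAvg_stress_le Λ hF hV (hν j) hm hn (hLH j) (hmom j) (hsup j) (hnoleak j)
  have hjj := hj j le_rfl
  exact hle.trans_lt (by simpa [hκ2def, hcdef, mul_div_assoc] using hjj)


/-! ### (b) The `x₀`-invariant (longitudinal) witness class is excluded -/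

/-- **No floor on the longitudinal class.** The crux restricted to `x₀`-INVARIANT classical witnesses
— classical solutions on `[0, ∞)` of the Doppler-forced system that do not depend on the streamwise
coordinate (streak arrays, their transients, every streamwise-independent state), with momentum
`V e₂`, forward energy bounds and no leakage — is FALSE: by `LongitudinalClassQuiet` (item 18134) such
solutions dissipate at most `ν κ²F²/(4V²(2πn)²)`, so by `neg_longTimeAvg_stress_le` their stress is
`O(ν_j)` and no `ε₀ > 0` survives `ν_j → 0`. A witness of C1 must break the streamwise symmetry
shared by the force and the pattern. [folklore] -/
theorem not_quadratureStressFloor_longitudinalClass :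
    ¬ ∃ (F V : ℝ) (m n : ℕ), 0 < F ∧ 0 < V ∧ 0 < m ∧ 0 < n ∧ ∃ (Λ : GeneralizedLimit),
      ∃ (ν : ℕ → ℝ) (u : ℕ → ℝ → UnitAddTorus (Fin 3) → EuclideanSpace ℝ (Fin 3)) (p : ℕ → ℝ → UnitAddTorus (Fin 3) → ℝ),
        (∀ j, 0 < ν j) ∧ Tendsto ν atTop (𝓝 0) ∧
        (∀ j, IsClassicalNSSolutionOn (Set.Ici 0) (ν j)
          (fun _ => fun x : UnitAddTorus (Fin 3) => (F * (UnitAddTorus.mFourier (Pi.single (1 : Fin 3) ((m : ℕ) : ℤ)) x).im * (UnitAddTorus.mFourier (Pi.single (2 : Fin 3) ((n : ℕ) : ℤ)) x).re) • EuclideanSpace.single (0 : Fin 3) (1 : ℝ)) (u j) (p j)) ∧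
        (∀ j (t : ℝ) (c : UnitAddCircle) (x : UnitAddTorus (Fin 3)), u j t (x + Pi.single (0 : Fin 3) c) = u j t x) ∧
        (∀ j, ∫ x, u j 0 x = V • EuclideanSpace.single (2 : Fin 3) (1 : ℝ)) ∧
        (∀ j, ∃ C : ℝ, ∀ t : ℝ, 0 ≤ t → kineticEnergy (u j t) ≤ C) ∧
        (∀ j, longTimeAvgSup (fun t => ∫ x, ⟪(F * (UnitAddTorus.mFourier (Pi.single (1 : Fin 3) ((m : ℕ) : ℤ)) x).im * (UnitAddTorus.mFourier (Pi.single (2 : Fin 3) ((n : ℕ) : ℤ)) x).re) • EuclideanSpace.single (0 : Fin 3) (1 : ℝ), u j t x⟫) ≤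
          meanDissipation (ν j) (u j)) ∧
        ∃ ε₀ : ℝ, 0 < ε₀ ∧ ∀ j, ε₀ ≤ -Λ.longTimeAvg (fun t => ∫ x, ⟪u j t x - V • EuclideanSpace.single (2 : Fin 3) (1 : ℝ),
          convect (fun y => u j t y - V • EuclideanSpace.single (2 : Fin 3) (1 : ℝ)) (fun y : UnitAddTorus (Fin 3) => ((UnitAddTorus.mFourier (Pi.single (1 : Fin 3) ((m : ℕ) : ℤ)) y).im * (UnitAddTorus.mFourier (Pi.single (2 : Fin 3) ((n : ℕ) : ℤ)) y).im) • EuclideanSpace.single (0 : Fin 3) (1 : ℝ)) x⟫) := by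
  rintro ⟨F, V, m, n, hF, hV, hm, hn, Λ, ν, u, p, hν, hν0, hsol, hinv, hmom, hsup, hnoleak, ε₀, hε₀, hfloor⟩
  have hn' : (0 : ℝ) < (n : ℝ) := Nat.cast_pos.2 hn
  -- the class is quiet (item 18134) and classical solutions on `[0, ∞)` are global Leray–Hopf
  have hquiet : ∀ j, meanDissipation (ν j) (u j) ≤
      ν j * ((2 * Real.pi) ^ 2 * ((m : ℝ) ^ 2 + (n : ℝ) ^ 2)) * F ^ 2 / (4 * V ^ 2 * (2 * Real.pi * n) ^ 2) :=
    fun j => longitudinalClassQuiet_proof F V (ν j) m n (u j) (p j) hV (hν j) hn (hsol j) (hinv j) (hmom j)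
      (hsup j)
  have hLH : ∀ j, IsGlobalLerayHopf (ν j) (fun _ => fun x : UnitAddTorus (Fin 3) => (F * (UnitAddTorus.mFourier (Pi.single (1 : Fin 3) ((m : ℕ) : ℤ)) x).im * (UnitAddTorus.mFourier (Pi.single (2 : Fin 3) ((n : ℕ) : ℤ)) x).re) • EuclideanSpace.single (0 : Fin 3) (1 : ℝ))
      (u j 0) (u j) :=
    fun j T hT => (hsol j).isLerayHopfOn_of_convex (convex_Ici 0) hT Icc_subset_Ici_self
  -- hence `ε₀ ≤ ν_j · K` for a fixed constant `K`
  set K : ℝ := (V * (2 * Real.pi * n) / F + (2 * Real.pi) ^ 2 * ((m : ℝ) ^ 2 + (n : ℝ) ^ 2) / (8 * Real.pi ^ 2)) *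
      (((2 * Real.pi) ^ 2 * ((m : ℝ) ^ 2 + (n : ℝ) ^ 2)) * F ^ 2 / (4 * V ^ 2 * (2 * Real.pi * n) ^ 2)) +
    ((2 * Real.pi) ^ 2 * ((m : ℝ) ^ 2 + (n : ℝ) ^ 2)) / 2 with hKdef
  have hcoef : (0 : ℝ) ≤ V * (2 * Real.pi * n) / F +
      (2 * Real.pi) ^ 2 * ((m : ℝ) ^ 2 + (n : ℝ) ^ 2) / (8 * Real.pi ^ 2) := by positivity
  have key : ∀ j, ε₀ ≤ ν j * K := by
    intro j
    have h1 := hfloor j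
    have h2 := neg_longTimeAvg_stress_le Λ hF hV (hν j) hm hn (hLH j) (hmom j) (hsup j) (hnoleak j)
    have h3 := mul_le_mul_of_nonneg_left (hquiet j) hcoef
    have h4 : (V * (2 * Real.pi * n) / F + (2 * Real.pi) ^ 2 * ((m : ℝ) ^ 2 + (n : ℝ) ^ 2) / (8 * Real.pi ^ 2)) *
          (ν j * ((2 * Real.pi) ^ 2 * ((m : ℝ) ^ 2 + (n : ℝ) ^ 2)) * F ^ 2 / (4 * V ^ 2 * (2 * Real.pi * n) ^ 2)) +
        ν j * ((2 * Real.pi) ^ 2 * ((m : ℝ) ^ 2 + (n : ℝ) ^ 2)) / 2 = ν j * K := by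
      rw [hKdef]
      ring
    linarith
  -- but `ν_j · K → 0`
  have hlim : Tendsto (fun j => ν j * K) atTop (𝓝 0) := by simpa using hν0.mul_const K
  obtain ⟨j, hj⟩ := eventually_atTop.1 (hlim.eventually (gt_mem_nhds hε₀))
  exact lt_irrefl _ ((key j).trans_lt (hj j le_rfl))

end Summit.AnomalousDissipation.AnomalousDissipation.Theorems.QuadratureStressFloor.Negative

end
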